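import Summits.CriticalPhenomena.PercolationContinuityZ3.Theorems.Transplant.SkelFrmQuasi1RootHoldsQ3VR
import Summits.CriticalPhenomena.PercolationContinuityZ3.Theorems.Transplant.SkelFrmQuasi1RootHoldsQCKVOfLePx
import Summits.CriticalPhenomena.PercolationContinuityZ3.Theorems.Transplant.SkelFrmQuasi1RootHoldsQDKVOfLePx
import Summits.CriticalPhenomena.PercolationContinuityZ3.Theorems.Transplant.SkelFrmQuasi1RootGlueQVKPx
import Summits.CriticalPhenomena.PercolationContinuityZ3.Theorems.Transplant.SkelFrmQuasiBParamsKitBump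
import Summits.CriticalPhenomena.PercolationContinuityZ3.Theorems.Transplant.PlanarSkeletonFrmQuasiDefs
import Summits.CriticalPhenomena.PercolationContinuityZ3.Theorems.Transplant.PlanarSkeletonFrmQuasiProxies
import Summits.CriticalPhenomena.PercolationContinuityZ3.Theorems.Transplant.SkelFrmQuasi1ChoiceDefs
import Summits.CriticalPhenomena.PercolationContinuityZ3.Theorems.Transplant.SkelFrmQuasi1ParamsLBL
import Summits.CriticalPhenomena.PercolationContinuityZ3.Theorems.Transplant.SkelFrmQuasi1ParamsPO
import Summits.CriticalPhenomena.PercolationContinuityZ3.Theorems.Transplant.SkelFrmQuasiBChoiceArrivalYW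
import Summits.CriticalPhenomena.PercolationContinuityZ3.Theorems.Transplant.SkelFrmQuasiBChoiceAtQ
import Summits.CriticalPhenomena.PercolationContinuityZ3.Theorems.Transplant.SkelFrmQuasiBChoiceAtQ3V
import Summits.CriticalPhenomena.PercolationContinuityZ3.Theorems.Transplant.SkelFrmQuasiBChoiceCreepY3
import Summits.CriticalPhenomena.PercolationContinuityZ3.Theorems.Transplant.SkelFrmQuasiBChoiceDefs
import Summits.CriticalPhenomena.PercolationContinuityZ3.Theorems.Transplant.SkelFrmQuasiBChoiceDefsV
import Summits.CriticalPhenomena.PercolationContinuityZ3.Theorems.Transplant.SkelFrmQuasiBChoiceDefsVPx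
import Summits.CriticalPhenomena.PercolationContinuityZ3.Theorems.Transplant.SkelFrmQuasiBChoiceDepth2
import Summits.CriticalPhenomena.PercolationContinuityZ3.Theorems.Transplant.SkelFrmQuasiBChoiceDepthYW
import Summits.CriticalPhenomena.PercolationContinuityZ3.Theorems.Transplant.SkelFrmQuasiBChoiceLinks
import Summits.CriticalPhenomena.PercolationContinuityZ3.Theorems.Transplant.SkelFrmQuasiBChoiceNums
import Summits.CriticalPhenomena.PercolationContinuityZ3.Theorems.Transplant.SkelFrmQuasiBChoiceReadNums3
import Summits.CriticalPhenomena.PercolationContinuityZ3.Theorems.Transplant.SkelFrmQuasiBChoiceResidC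
import Summits.CriticalPhenomena.PercolationContinuityZ3.Theorems.Transplant.SkelFrmQuasiBChoiceRootDiamV
import Summits.CriticalPhenomena.PercolationContinuityZ3.Theorems.Transplant.SkelFrmQuasiBChoiceRootLanding
import Summits.CriticalPhenomena.PercolationContinuityZ3.Theorems.Transplant.SkelFrmQuasiBChoiceRootLanding2
import Summits.CriticalPhenomena.PercolationContinuityZ3.Theorems.Transplant.SkelFrmQuasiBChoiceRootPrefix
import Summits.CriticalPhenomena.PercolationContinuityZ3.Theorems.Transplant.SkelFrmQuasiBChoiceRootReadDefs
import Summits.CriticalPhenomena.PercolationContinuityZ3.Theorems.Transplant.SkelFrmQuasiBChoiceRootReadX2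
import Summits.CriticalPhenomena.PercolationContinuityZ3.Theorems.Transplant.SkelFrmQuasiBChoiceRootReadY
import Summits.CriticalPhenomena.PercolationContinuityZ3.Theorems.Transplant.SkelFrmQuasiBChoiceRootReadYk
import Summits.CriticalPhenomena.PercolationContinuityZ3.Theorems.Transplant.SkelFrmQuasiBChoiceRootRunY
import Summits.CriticalPhenomena.PercolationContinuityZ3.Theorems.Transplant.SkelFrmQuasiBChoiceWindow3
import Summits.CriticalPhenomena.PercolationContinuityZ3.Theorems.Transplant.SkelFrmQuasiBParamsBridge0
import Summits.CriticalPhenomena.PercolationContinuityZ3.Theorems.Transplant.SkelFrmQuasiBParamsCorrKG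
import Summits.CriticalPhenomena.PercolationContinuityZ3.Theorems.Transplant.SkelFrmQuasiBParamsCorrKG0
import Summits.CriticalPhenomena.PercolationContinuityZ3.Theorems.Transplant.SkelFrmQuasiBParamsCorrKGLen3
import Summits.CriticalPhenomena.PercolationContinuityZ3.Theorems.Transplant.SkelFrmQuasiBParamsCorrKGLenY
import Summits.CriticalPhenomena.PercolationContinuityZ3.Theorems.Transplant.SkelFrmQuasiBParamsLF
import Summits.CriticalPhenomena.PercolationContinuityZ3.Theorems.Transplant.SkelFrmQuasiBParamsLFA
import Summits.CriticalPhenomena.PercolationContinuityZ3.Theorems.Transplant.SkelFrmQuasiBParamsSlotsS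
import Summits.CriticalPhenomena.PercolationContinuityZ3.Theorems.Transplant.SkelFrmQuasi1SlotTypes
import Summits.CriticalPhenomena.PercolationContinuityZ3.Theorems.Transplant.SkelPhiQStepsN
import HarnessLib

/-!
# GEN-Q PORT (WAVE-Q table v0.8 section 2, row G254, U-level L?; captain R-6/R-7 2026-08-27: carrier token swap `PlanarSkeletonFrmFrom ↦ PlanarSkeletonFrmQuasi`)
# of the tree module «Transplant/SkelFrmFrom1RootHoldsQ3VRPx» (sha256 f5e797ed06cb6219…) onto the quasi-step carrier `PlanarSkeletonFrmQuasi` (p507026): «SkelFrmQuasi1RootHoldsQ3VRPx»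

ORIGINAL TITLE: 

builds on p205010 (kernel theorem, internal audit signed; external expert review pending) — nothing in this file uses p205010; NOTHING is claimed about any open node
((N3-b), the end state).  Lane `prim-bschramm`, seat `prim-hp-8` (gen 62; GEN-Q pen, family BChoiceRoot*/1Root*/BParamsKit·Bridge; tool = captain gen-1 g4's port_genq.py R-14 + p3-g30 T1/T2 + stmt-g33 --force-keep).  Helper file (`--supports stmt-CriticalPhenomena-4575 --as helper`).
PORT RULES (U-wave r1–r4 re-used, GEN-Q hunk classes of p3-g29 #6136): declaration order, names and proof texts are those of «SkelFrmFrom1RootHoldsQ3VRPx», byte-identical except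
(i) the carrier token `PlanarSkeletonFrmFrom ↦ PlanarSkeletonFrmQuasi` in binders, `namespace`/`end` lines and qualified names (module names `SkelFrmFrom… ↦ SkelFrmQuasi…`
in imports of already-ported rows); (ii) `Φ.step ↦ Φ.qstep` with the called Steps lemma replaced by its `…Q`/`_q` twin and the cost `Φ.M` threaded (none in this file unless
listed below); (iii) `Φ.cyl_connected ↦ Φ.cyl_reach` readers (none unless listed); (iv) graph-ball radii / window floors ×`Φ.M` (none unless listed).  HAND HUNK (L-KitS-1 readers): the kit integers of record are read at the window cost
`N := KS.NQ Φ` — KS0.R'0 ↦ KS0.R'0N κ Φ (KS.NQ Φ) ×6; KS0.r₀0 ↦ KS0.r₀0N ×6 (N first) (stmt-g33's G017 «SkelFrmQuasiBChoiceNums», hp-8's «SkelFrmQuasiBParamsKitSN»).  Carrier-free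
residents stay imported/exported from the original «SkelFrm1RootHoldsQ3VRPx» exactly as in the FrmFrom port.  Docstrings and citations are the original's.

K-2 READER HUNKS (p3-g30, design owner, R-25 2026-08-27; hp-8 g62's tool port + these hunks; validated rc 0 kept whole over the staged closure):
(iv) L-p3g30-1 / L-p5g29-2: the excess-floor binders and the `Hex` conjuncts read ×`Φ.M` — `Φ.M·Yb0 + 1 ≤ ex`, `Φ.M·D0s + ZD2 + Φ.M·13·kgSL.toNat + 1 ≤ ex`,
`Φ.M·D0s(0) + ZDP + 1 ≤ ex`, `Φ.M·D2R + ZDYW + Φ.M·13·nL + 1 ≤ ex` (= p3-g30's «SkelFrmQuasiBChoiceResidR» `exR0_floors` conjuncts 3–6 verbatim); the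
hand-offs `(by exact_mod_cast hZ)` feed gen-2 g0's `reach_le_ZD2 / reachY_le_ZDYW` (`↑(Φ.M·13)·(…) ≤ ZD2/ZDYW`) to the wrappers' `hZ/hZY`.
-/

noncomputable section

open scoped Classical

namespace Summit.CriticalPhenomena.PercolationContinuityZ3.Theorems.Transplant

open MeasureTheory Literature.Probability.Percolation Literature.Probability.LatticeModels SimpleGraph KNCells KNLevels
open Literature.Barriers.CriticalPhenomena (graphBall)
open SkelConc (Consts)
open Skelφ (rootFrame shearUnit kgSL kgZ₀ kgZ₁ kgM₁ kgM₂ kgWm₂ kgWp₂ kgZY₀ kgZY₁ kgM₁Y kgM₂Y kgWm₂Y kgWp₂Y rdLo rdHi)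
open Skelφ.StepI (DataN DataNS OutNS)
open Skel (winGraph)

namespace PlanarSkeletonFrmQuasi

namespace NegB

open Neg

variable {κ : Consts} {V : Type} [DecidableEq V] [Countable V] {G : SimpleGraph V} [G.LocallyFinite] {Φ : PlanarSkeletonFrmQuasi G} {t : V} {p : unitInterval}
  {hC : Φ.CylSubcritical p} {gv fv : Neg.FSlot} {Pv : PSlot} {ex mx : GSlot} {cv hv : CSlot} {bv : BSlot} {O : OutNS V} {q : unitInterval}

/-! ## §1 The first-axis root leg from floors and two reading rows, under proxies (the window facts `qxYQ4_rows`/`WxYQ4_rows` of the U twin are index-generic and used as they stand) -/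

set_option maxHeartbeats 3200000 in
/-- **THE FIRST-AXIS ROOT LEG AT THE V CHOICES OF RECORD, ERA-3 WINDOWS, FROM SLOT FLOORS AND TWO BOX-READING ROWS — UNDER PROXIES** (GEN twin of `rootLeg_fst_Q3V_of_rows`: `hP : Φ.HasProxies t D` for `Φ.types = {t}`, slot floors / landed rows at the RAISED kit index `mkP` with `hRK`, radii `+ D`, width floors explicit; over «SkelFrmFrom1RootHoldsQCKVOfLePx») ((R-X1) the x-corridor box,
(R-XA) the widened x-arrival box). [cite: KozmaNitzan2024, §4 p. 28 ((32) at the root)] -/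
theorem rootLeg_fst_Q3V_of_rowsPx {κ : Consts} {V : Type} [DecidableEq V] [Countable V] {G : SimpleGraph V} [G.LocallyFinite] {Φ : PlanarSkeletonFrmQuasi G} {t : V} {p : unitInterval} {hC : Φ.CylSubcritical p} {gv : Neg.FSlot} {fv : Neg.FSlot} {Pv : PSlot} {ex : GSlot} {mx : GSlot} {cv : CSlot} {hv : CSlot} {bv : BSlot} {O : OutNS V} {q : unitInterval} (hAt : (choiceAtQ3V κ Φ t p Pv gv fv (SUS ex mx) cv hv bv hC).AtQNQ O q) {D : ℕ} (hP : Φ.HasProxies t D)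
    (hp0 : 0 < (p : ℝ)) (hp1 : (p : ℝ) < 1) (mk mkP : ℕ)
    -- UNDER PROXIES: the width floors (C-4) and the RAISED KIT INDEX `mkP` (K-2; the served region / kit pair stays at `mk`)
    (hnL : D ≤ nL κ Φ t p O.merged (gOf κ Φ t p O gv) (fOf κ Φ t p O fv)) (hnK : D ≤ KS.nKit O.merged mk) (hDk : D ≤ O.merged.k)
    (hnB0 : D ≤ KS.nB0 κ Φ t p O.merged mkP) (hRK : KS.RK t O.merged mk + D ≤ KS.RK t O.merged mkP)
    (hgK : gFloorKG κ Φ t p O.merged mkP ≤ gOf κ Φ t p O gv) (hg2 : 40 * Neg.K κ * KS0.R'0N κ Φ (KS.NQ Φ) t p O.merged mkP ≤ gOf κ Φ t p O gv)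
    (hfg : 2 * fOf κ Φ t p O fv + 5 * KS0.R'0N κ Φ (KS.NQ Φ) t p O.merged mkP + 3 ≤ gOf κ Φ t p O gv) (hf : KS.fxR0 κ Φ t p O.merged mkP ≤ fOf κ Φ t p O fv)
    (hexRL : KS0.r₀0N (KS.NQ Φ) t O.merged mkP (RL κ Φ t p O gv fv + D) + 1 ≤ ex κ Φ t p O.merged (gOf κ Φ t p O gv) (fOf κ Φ t p O fv)) (hexRB : KS0.r₀0N (KS.NQ Φ) t O.merged mkP (KS.RB0 κ Φ t p O.merged mkP + D) + 1 ≤ ex κ Φ t p O.merged (gOf κ Φ t p O gv) (fOf κ Φ t p O fv))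
    (hexYb : Φ.M * KS.Yb0 κ Φ t p O.merged mkP (gOf κ Φ t p O gv) (fOf κ Φ t p O fv) + 1 ≤ ex κ Φ t p O.merged (gOf κ Φ t p O gv) (fOf κ Φ t p O fv))
    (hexZ : Φ.M * KS.D0s κ Φ t p O.merged mkP (gOf κ Φ t p O gv) (fOf κ Φ t p O fv) (kgq κ Φ t p O.merged (gOf κ Φ t p O gv) (fOf κ Φ t p O fv) (qxQ4 κ Φ t p O.merged (gOf κ Φ t p O gv) (fOf κ Φ t p O fv))) + ZD2 κ Φ t p O.merged (gOf κ Φ t p O gv) (fOf κ Φ t p O fv) + Φ.M * 13 * (kgSL (nL κ Φ t p O.merged (gOf κ Φ t p O gv) (fOf κ Φ t p O fv)) (ℓL κ Φ t p O.merged (gOf κ Φ t p O gv) (fOf κ Φ t p O fv)) (hL κ Φ t p O.merged (gOf κ Φ t p O gv) (fOf κ Φ t p O fv))).toNat + 1 ≤ ex κ Φ t p O.merged (gOf κ Φ t p O gv) (fOf κ Φ t p O fv))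
    (hPx : (KS.Px0 mkP κ Φ t p O.merged).1 ⊆ (Pv κ Φ t p O.merged).1)
    (hRs5 : ∀ i, KS.Rs t O.merged mkP + 1 ≤ 5 * ((fcellsA κ Φ t p O.merged (gOf κ Φ t p O gv) (fOf κ Φ t p O fv))).r i)
    (hrowX1 : KS.RowX1 κ Φ t p O.merged mkP (gOf κ Φ t p O gv) (fOf κ Φ t p O fv) (qxQ4 κ Φ t p O.merged (gOf κ Φ t p O gv) (fOf κ Φ t p O fv)) (WxQ4 κ Φ t p O.merged (gOf κ Φ t p O gv) (fOf κ Φ t p O fv)))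
    (hrowXA : KS.RowXA κ Φ t p O.merged mkP (gOf κ Φ t p O gv) (fOf κ Φ t p O fv) (qxQ4 κ Φ t p O.merged (gOf κ Φ t p O gv) (fOf κ Φ t p O fv)) (WxQ4 κ Φ t p O.merged (gOf κ Φ t p O gv) (fOf κ Φ t p O fv)) (cOf κ Φ t p O gv fv cv) (bOf κ Φ t p O gv fv bv) (eqNumL_of_atQ (atQ3_of_atQ3V hAt)) hgK) :
    ∃ n, n ≤ LfQ κ.K₀ ∧ ∃ (c : V) (Rπ : ℕ) (W : Sym2 V → unitInterval) (s : Fin (n + 1) → KNLevels.TStep (winGraph G c Rπ))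
      (T' : Fin (n + 1) → Finset V) (η' : ℝ),
      (∀ T : Finset V, (prodBernoulli W).real (⋃ t' ∈ T, openConn (ΓQV κ Φ t p O gv fv (SUS ex mx) cv hv bv q).root t') ≤
        (prodBernoulli (pinW (KNLevels.lattW G q) ↑((⟨ΓQV κ Φ t p O gv fv (SUS ex mx) cv hv bv q, q, κ.δ⟩ : KSchA V ℕ).U₀ G)
          ↑((⟨ΓQV κ Φ t p O gv fv (SUS ex mx) cv hv bv q, q, κ.δ⟩ : KSchA V ℕ).U₀ G))).real
          (⋃ t' ∈ (↑T : Set V), openConnIn (↑((ΓQV κ Φ t p O gv fv (SUS ex mx) cv hv bv q).Q (ΓQV κ Φ t p O gv fv (SUS ex mx) cv hv bv q).a₀ 0 ∪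
            (ΓQV κ Φ t p O gv fv (SUS ex mx) cv hv bv q).Ewv (ΓQV κ Φ t p O gv fv (SUS ex mx) cv hv bv q).a₀ 0 (((0 : Fin 2), true) : MDir)) : Set V)
            (ΓQV κ Φ t p O gv fv (SUS ex mx) cv hv bv q).root t')) ∧
      (∀ i : Fin (n + 1), (s i).L.o = (ΓQV κ Φ t p O gv fv (SUS ex mx) cv hv bv q).root) ∧
      (∀ i : Fin n, T' (Fin.castSucc i) ⊆ (s i.succ).L.X 0) ∧ (∀ i : Fin (n + 1), T' i ⊆ (s i).T) ∧
      (∀ i : Fin (n + 1), (s i).KitsAtF W q Φ.Δ (κ.δr 0)) ∧ η' ≤ κ.δr 0 / 2 ∧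
      (∀ i : Fin (n + 1), (prodBernoulli W).real (⋃ t' ∈ (s i).T \ T' i, openConn (ΓQV κ Φ t p O gv fv (SUS ex mx) cv hv bv q).root t') ≤ η') ∧
      1 - κ.δr 0 < (prodBernoulli W).real (s 0).L.reachB ∧
      T' (Fin.last n) ⊆ (ΓQV κ Φ t p O gv fv (SUS ex mx) cv hv bv q).M (ΓQV κ Φ t p O gv fv (SUS ex mx) cv hv bv q).a₀ ((0 : Site 2) + stepVec (((0 : Fin 2), true) : MDir)) := by
  have hN := eqNumL_of_atQ (atQ3_of_atQ3V hAt)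
  have hx3 := kgRes3_Q4 κ Φ t p O.merged (gOf κ Φ t p O gv) (fOf κ Φ t p O fv) hN
  have hZ := reach_le_ZD2 κ Φ t p O.merged (gOf κ Φ t p O gv) (fOf κ Φ t p O fv) mkP hN hgK hg2
  have h0C := kgFar_zero_le_kgTgt0_4 κ Φ t p O.merged (gOf κ Φ t p O gv) (fOf κ Φ t p O fv) mkP hN hgK
  refine rootLegAt_frmQ3KV_fst_of_lePx hAt hP hp0 hp1 mk mkP hnL hnK hDk hnB0 hRK (qxQ4 κ Φ t p O.merged (gOf κ Φ t p O gv) (fOf κ Φ t p O fv)) (WxQ4 κ Φ t p O.merged (gOf κ Φ t p O gv) (fOf κ Φ t p O fv)) (ZD2 κ Φ t p O.merged (gOf κ Φ t p O gv) (fOf κ Φ t p O fv)) hgK hg2 hfg hf hexRL hexRB hexYb hexZ hPx hx3.hqx hx3.hWx hx3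
    (by exact_mod_cast hZ) hRs5 ?_ ?_ ?_ ?_
  · intro w _ hw
    exact KS.hfoot₁_R κ Φ t p O.merged mkP (gOf κ Φ t p O gv) (fOf κ Φ t p O fv) (qxQ4 κ Φ t p O.merged (gOf κ Φ t p O gv) (fOf κ Φ t p O fv)) (WxQ4 κ Φ t p O.merged (gOf κ Φ t p O gv) (fOf κ Φ t p O fv)) (cOf κ Φ t p O gv fv cv) hN hf hfg
      (by simp) (by simp) (by simp) (by simp) ((KS.readRow_iff κ Φ t p O.merged (gOf κ Φ t p O gv) (fOf κ Φ t p O fv) _ _ _ _ _ _).1 hrowX1) w hw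
  · intro c₁ hX hY k hk w _ hw
    exact KS.hfoot₂_R κ Φ t p O.merged mkP (gOf κ Φ t p O gv) (fOf κ Φ t p O fv) (qxQ4 κ Φ t p O.merged (gOf κ Φ t p O gv) (fOf κ Φ t p O fv)) (WxQ4 κ Φ t p O.merged (gOf κ Φ t p O gv) (fOf κ Φ t p O fv)) (cOf κ Φ t p O gv fv cv) hN hgK hg2 hx3.hqx hx3.hWx hf
      (by simp) (by simp) (by simp) (by simp) ((KS.readRow_iff κ Φ t p O.merged (gOf κ Φ t p O gv) (fOf κ Φ t p O fv) _ _ _ _ _ _).1 hrowX1) hX hY k hk w hw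
  · intro c₁ hX hY w _ hw
    exact KS.hlastf_R κ Φ t p O.merged mkP (gOf κ Φ t p O gv) (fOf κ Φ t p O fv) (qxQ4 κ Φ t p O.merged (gOf κ Φ t p O gv) (fOf κ Φ t p O fv)) (WxQ4 κ Φ t p O.merged (gOf κ Φ t p O gv) (fOf κ Φ t p O fv)) (cOf κ Φ t p O gv fv cv) hN hgK hg2 hx3.hqx hx3.hWx hf h0C (bOf κ Φ t p O gv fv bv)
      (by simp) (by simp) (by simp) (by simp) ((KS.readRow_iff κ Φ t p O.merged (gOf κ Φ t p O gv) (fOf κ Φ t p O fv) _ _ _ _ _ _).1 hrowXA) hX hY w hw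
  · exact hDm_R κ Φ t p O gv fv (SUS ex mx) cv hv bv q mx hN _ _ _

/-! ## §2 The second-axis root leg from floors and three reading rows, under proxies -/

set_option maxHeartbeats 3200000 in
/-- **THE SECOND-AXIS ROOT LEG AT THE V CHOICES OF RECORD, ERA-3 WINDOWS, FROM SLOT FLOORS AND THREE BOX-READING ROWS — UNDER PROXIES** (GEN twin of `rootLeg_snd_Q3V_of_rows`, same hunks as §2; over «SkelFrmFrom1RootHoldsQDKVOfLePx») ((R-X2) the x-prefix box,
(R-YA) the widened y′-arrival box; the y′-corridor regions are read per region INSIDE, `KS.hfoot₃_Rk`, ruling (R-50)); needs `200 ≤ κ.K₀` (`Kq ≥ 5` for stmt's y′ value rows). [cite: KozmaNitzan2024, §4 p. 28 ((32) at the root)] -/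
theorem rootLeg_snd_Q3V_of_rowsPx {κ : Consts} {V : Type} [DecidableEq V] [Countable V] {G : SimpleGraph V} [G.LocallyFinite] {Φ : PlanarSkeletonFrmQuasi G} {t : V} {p : unitInterval} {hC : Φ.CylSubcritical p} {gv : Neg.FSlot} {fv : Neg.FSlot} {Pv : PSlot} {ex : GSlot} {mx : GSlot} {cv : CSlot} {hv : CSlot} {bv : BSlot} {O : OutNS V} {q : unitInterval} (hAt : (choiceAtQ3V κ Φ t p Pv gv fv (SUS ex mx) cv hv bv hC).AtQNQ O q) {D : ℕ} (hP : Φ.HasProxies t D)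
    (hp0 : 0 < (p : ℝ)) (hp1 : (p : ℝ) < 1) (mk mkP : ℕ)
    -- UNDER PROXIES: the width floors (C-4) and the RAISED KIT INDEX `mkP` (K-2; the served region / kit pair stays at `mk`)
    (hnL : D ≤ nL κ Φ t p O.merged (gOf κ Φ t p O gv) (fOf κ Φ t p O fv)) (hnK : D ≤ KS.nKit O.merged mk) (hDk : D ≤ O.merged.k)
    (hnB0 : D ≤ KS.nB0 κ Φ t p O.merged mkP) (hRK : KS.RK t O.merged mk + D ≤ KS.RK t O.merged mkP) (hK : 200 ≤ κ.K₀)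
    (hgK : gFloorKG κ Φ t p O.merged mkP ≤ gOf κ Φ t p O gv) (hg2 : 40 * Neg.K κ * KS0.R'0N κ Φ (KS.NQ Φ) t p O.merged mkP ≤ gOf κ Φ t p O gv)
    (hgR : 60 * (KS.Rs t O.merged mkP + 1) ≤ gOf κ Φ t p O gv)
    (hfg : 2 * fOf κ Φ t p O fv + 5 * KS0.R'0N κ Φ (KS.NQ Φ) t p O.merged mkP + 3 ≤ gOf κ Φ t p O gv) (hf : KS.fxR0 κ Φ t p O.merged mkP ≤ fOf κ Φ t p O fv)
    (hexRL : KS0.r₀0N (KS.NQ Φ) t O.merged mkP (RL κ Φ t p O gv fv + D) + 1 ≤ ex κ Φ t p O.merged (gOf κ Φ t p O gv) (fOf κ Φ t p O fv)) (hexRB : KS0.r₀0N (KS.NQ Φ) t O.merged mkP (KS.RB0 κ Φ t p O.merged mkP + D) + 1 ≤ ex κ Φ t p O.merged (gOf κ Φ t p O gv) (fOf κ Φ t p O fv))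
    (hexYb : Φ.M * KS.Yb0 κ Φ t p O.merged mkP (gOf κ Φ t p O gv) (fOf κ Φ t p O fv) + 1 ≤ ex κ Φ t p O.merged (gOf κ Φ t p O gv) (fOf κ Φ t p O fv))
    (hexP : Φ.M * KS.D0s κ Φ t p O.merged mkP (gOf κ Φ t p O gv) (fOf κ Φ t p O fv) (kgq κ Φ t p O.merged (gOf κ Φ t p O gv) (fOf κ Φ t p O fv) 0) + KS.ZDP κ Φ t p O.merged (gOf κ Φ t p O gv) (fOf κ Φ t p O fv) + 1 ≤ ex κ Φ t p O.merged (gOf κ Φ t p O gv) (fOf κ Φ t p O fv))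
    (hexY : Φ.M * KS.D2R κ Φ t p O.merged mkP (gOf κ Φ t p O gv) (fOf κ Φ t p O fv) (WxYQ4 κ Φ t p O.merged (gOf κ Φ t p O gv) (fOf κ Φ t p O fv)) + ZDYW κ Φ t p O.merged (gOf κ Φ t p O gv) (fOf κ Φ t p O fv) + Φ.M * 13 * (nL κ Φ t p O.merged (gOf κ Φ t p O gv) (fOf κ Φ t p O fv)) + 1 ≤ ex κ Φ t p O.merged (gOf κ Φ t p O gv) (fOf κ Φ t p O fv))
    (hPx : (KS.Px0 mkP κ Φ t p O.merged).1 ⊆ (Pv κ Φ t p O.merged).1)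
    (hRs5 : ∀ i, KS.Rs t O.merged mkP + 1 ≤ 5 * ((fcellsA κ Φ t p O.merged (gOf κ Φ t p O gv) (fOf κ Φ t p O fv))).r i)
    (hrowX2 : KS.RowX2 κ Φ t p O.merged mkP (gOf κ Φ t p O gv) (fOf κ Φ t p O fv))
    (hrowYA : KS.RowYA κ Φ t p O.merged mkP (gOf κ Φ t p O gv) (fOf κ Φ t p O fv) (qxYQ4 κ Φ t p O.merged (gOf κ Φ t p O gv) (fOf κ Φ t p O fv)) (WxYQ4 κ Φ t p O.merged (gOf κ Φ t p O gv) (fOf κ Φ t p O fv)) (cOf κ Φ t p O gv fv cv) (bOf κ Φ t p O gv fv bv) (eqNumL_of_atQ (atQ3_of_atQ3V hAt)) hgK) :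
    ∃ n, n ≤ LfQ κ.K₀ ∧ ∃ (c : V) (Rπ : ℕ) (W : Sym2 V → unitInterval) (s : Fin (n + 1) → KNLevels.TStep (winGraph G c Rπ))
      (T' : Fin (n + 1) → Finset V) (η' : ℝ),
      (∀ T : Finset V, (prodBernoulli W).real (⋃ t' ∈ T, openConn (ΓQV κ Φ t p O gv fv (SUS ex mx) cv hv bv q).root t') ≤
        (prodBernoulli (pinW (KNLevels.lattW G q) ↑((⟨ΓQV κ Φ t p O gv fv (SUS ex mx) cv hv bv q, q, κ.δ⟩ : KSchA V ℕ).U₀ G)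
          ↑((⟨ΓQV κ Φ t p O gv fv (SUS ex mx) cv hv bv q, q, κ.δ⟩ : KSchA V ℕ).U₀ G))).real
          (⋃ t' ∈ (↑T : Set V), openConnIn (↑((ΓQV κ Φ t p O gv fv (SUS ex mx) cv hv bv q).Q (ΓQV κ Φ t p O gv fv (SUS ex mx) cv hv bv q).a₀ 0 ∪
            (ΓQV κ Φ t p O gv fv (SUS ex mx) cv hv bv q).Ewv (ΓQV κ Φ t p O gv fv (SUS ex mx) cv hv bv q).a₀ 0 (((1 : Fin 2), true) : MDir)) : Set V)
            (ΓQV κ Φ t p O gv fv (SUS ex mx) cv hv bv q).root t')) ∧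
      (∀ i : Fin (n + 1), (s i).L.o = (ΓQV κ Φ t p O gv fv (SUS ex mx) cv hv bv q).root) ∧
      (∀ i : Fin n, T' (Fin.castSucc i) ⊆ (s i.succ).L.X 0) ∧ (∀ i : Fin (n + 1), T' i ⊆ (s i).T) ∧
      (∀ i : Fin (n + 1), (s i).KitsAtF W q Φ.Δ (κ.δr 0)) ∧ η' ≤ κ.δr 0 / 2 ∧
      (∀ i : Fin (n + 1), (prodBernoulli W).real (⋃ t' ∈ (s i).T \ T' i, openConn (ΓQV κ Φ t p O gv fv (SUS ex mx) cv hv bv q).root t') ≤ η') ∧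
      1 - κ.δr 0 < (prodBernoulli W).real (s 0).L.reachB ∧
      T' (Fin.last n) ⊆ (ΓQV κ Φ t p O gv fv (SUS ex mx) cv hv bv q).M (ΓQV κ Φ t p O gv fv (SUS ex mx) cv hv bv q).a₀ ((0 : Site 2) + stepVec (((1 : Fin 2), true) : MDir)) := by
  have hN := eqNumL_of_atQ (atQ3_of_atQ3V hAt)
  have hKq : 5 ≤ Neg.Kq κ := PlanarSkeletonNeg.Neg.kq_ge_of_le κ (m := 4) (by omega)
  have hxY := kgResY3_Q4 κ Φ t p O.merged (gOf κ Φ t p O gv) (fOf κ Φ t p O fv) hN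
  obtain ⟨hq3, hqx20⟩ := qxYQ4_rows hAt
  obtain ⟨hWxY, hWx45, hWx100⟩ := WxYQ4_rows hAt mkP hgK hg2 hgR
  have hZY := reachY_le_ZDYW κ Φ t p O.merged (gOf κ Φ t p O gv) (fOf κ Φ t p O fv) mkP hKq hN hgK hg2
  have h0Y := farY_zero_le_tgtY0_W κ Φ t p O.merged (gOf κ Φ t p O gv) (fOf κ Φ t p O fv) mkP hKq hN hgK hg2
  have hNle : (((kgNYv0 κ Φ t p O.merged (gOf κ Φ t p O gv) (fOf κ Φ t p O fv) mkP (qxYQ4 κ Φ t p O.merged (gOf κ Φ t p O gv) (fOf κ Φ t p O fv)) (WxYQ4 κ Φ t p O.merged (gOf κ Φ t p O gv) (fOf κ Φ t p O fv))) : ℕ) : ℤ) ≤ 21 * ((Neg.K κ : ℕ) : ℤ) + 2 := by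
    exact_mod_cast kgNYv0_le κ Φ t p O.merged (gOf κ Φ t p O gv) (fOf κ Φ t p O fv) mkP (qxYQ4 κ Φ t p O.merged (gOf κ Φ t p O gv) (fOf κ Φ t p O fv)) (WxYQ4 κ Φ t p O.merged (gOf κ Φ t p O gv) (fOf κ Φ t p O fv)) hN hgK
  obtain ⟨-, hXY22⟩ := XY_le_3 κ Φ t p O.merged (gOf κ Φ t p O gv) (fOf κ Φ t p O fv) mkP hKq hN hgK hg2 (kgNYv0 κ Φ t p O.merged (gOf κ Φ t p O gv) (fOf κ Φ t p O fv) mkP (qxYQ4 κ Φ t p O.merged (gOf κ Φ t p O gv) (fOf κ Φ t p O fv)) (WxYQ4 κ Φ t p O.merged (gOf κ Φ t p O gv) (fOf κ Φ t p O fv))) hNle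
  have hsL0 : (0 : ℤ) ≤ kgSL (nL κ Φ t p O.merged (gOf κ Φ t p O gv) (fOf κ Φ t p O fv)) (ℓL κ Φ t p O.merged (gOf κ Φ t p O gv) (fOf κ Φ t p O fv)) (hL κ Φ t p O.merged (gOf κ Φ t p O gv) (fOf κ Φ t p O fv)) := by
    have := ML_sub_one_le_kgSL κ Φ t p O.merged (gOf κ Φ t p O gv) (fOf κ Φ t p O fv) hN
    have h960 := slack_floor_le_ML κ Φ t p O.merged (gOf κ Φ t p O gv)
    have hM : (1 : ℤ) ≤ ML κ Φ t p O.merged (gOf κ Φ t p O gv) := by exact_mod_cast (show 1 ≤ ML κ Φ t p O.merged (gOf κ Φ t p O gv) by omega)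
    linarith
  have hXY : _ ≤ 100 * (kgSL (nL κ Φ t p O.merged (gOf κ Φ t p O gv) (fOf κ Φ t p O fv)) (ℓL κ Φ t p O.merged (gOf κ Φ t p O gv) (fOf κ Φ t p O fv)) (hL κ Φ t p O.merged (gOf κ Φ t p O gv) (fOf κ Φ t p O fv))) := hXY22.trans (by linarith)
  refine rootLegAt_frmQ3KV_snd_of_lePx hAt hP hp0 hp1 mk mkP hnL hnK hDk hnB0 hRK (qxYQ4 κ Φ t p O.merged (gOf κ Φ t p O gv) (fOf κ Φ t p O fv)) (WxYQ4 κ Φ t p O.merged (gOf κ Φ t p O gv) (fOf κ Φ t p O fv)) (ZDYW κ Φ t p O.merged (gOf κ Φ t p O gv) (fOf κ Φ t p O fv)) hgK hg2 hgR hfg hf hexRL hexRB hexYb hexP hexY hPx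
    hWxY hWx45 hq3 hqx20 hxY h0Y hXY (by exact_mod_cast hZY) hRs5 ?_ ?_ ?_ ?_ ?_
  · intro w _ hw
    exact KS.hfoot₁_RY κ Φ t p O.merged mkP (gOf κ Φ t p O gv) (fOf κ Φ t p O fv) (cOf κ Φ t p O gv fv cv) hN hf hfg
      (by simp) (by simp) (by simp) (by simp) ((KS.readRow_iff κ Φ t p O.merged (gOf κ Φ t p O gv) (fOf κ Φ t p O fv) _ _ _ _ _ _).1 hrowX2) w hw
  · intro c₁ hX hY k hk w _ hw
    exact KS.hfoot₂_RY κ Φ t p O.merged mkP (gOf κ Φ t p O gv) (fOf κ Φ t p O fv) (cOf κ Φ t p O gv fv cv) hN hgK hf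
      (by simp) (by simp) (by simp) (by simp) ((KS.readRow_iff κ Φ t p O.merged (gOf κ Φ t p O gv) (fOf κ Φ t p O fv) _ _ _ _ _ _).1 hrowX2) hX hY k hk w hw
  · intro c₂ hX hY k hk w _ hw
    exact KS.hfoot₃_Rk κ Φ t p O.merged mkP (gOf κ Φ t p O gv) (fOf κ Φ t p O fv) (qxYQ4 κ Φ t p O.merged (gOf κ Φ t p O gv) (fOf κ Φ t p O fv)) (WxYQ4 κ Φ t p O.merged (gOf κ Φ t p O gv) (fOf κ Φ t p O fv)) (cOf κ Φ t p O gv fv cv)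
      hKq hN hgK hg2 hWxY hWx100 hqx20 hX hY k hk w hw
  · intro c₂ hX hY w _ hw
    exact KS.hlastf_RY κ Φ t p O.merged mkP (gOf κ Φ t p O gv) (fOf κ Φ t p O fv) (qxYQ4 κ Φ t p O.merged (gOf κ Φ t p O gv) (fOf κ Φ t p O fv)) (WxYQ4 κ Φ t p O.merged (gOf κ Φ t p O gv) (fOf κ Φ t p O fv)) (cOf κ Φ t p O gv fv cv) hN hgK hg2 hf hWxY hWx100 (bOf κ Φ t p O gv fv bv)
      (by simp) (by simp) (by simp) (by simp) ((KS.readRow_iff κ Φ t p O.merged (gOf κ Φ t p O gv) (fOf κ Φ t p O fv) _ _ _ _ _ _).1 hrowYA) hX hY w hw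
  · exact hDm_R κ Φ t p O gv fv (SUS ex mx) cv hv bv q mx hN _ _ _

/-! ## §3 The GEN (R) column Prop at radius `D` from slot dominations at the raised index and the four reading rows -/

/-- **THE GEN (R) COLUMN K-PROP AT RADIUS `D` OF THE SEVEN-SLOT CHOICE FUNCTION OF RECORD** `RootHoldsNQWFnLKPxAt LfQ Kmin (frmChoiceAllQ3VPx D gv fv Pv (SUS ex mx) cv hv bv)`
— GEN twin of `rootHoldsNQWFnLK_frmChoiceAllQ3V_R`, the ∀-D shape of RULING Us-R5 (ii) — for ANY slots dominating the (R) residuals AT THE RAISED KIT INDEX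
`KS.RK t Dr mk + D` of every record `Dr` (K-2): `HgR` (box: `gFloorKG`, `40·K·R'0`, `60·(Rs + 1)`, `2f + 5·R'0 + 3`), `HfR` (width `fxR0`), `HexR` (the six window floors
with radii `RLD + D`, `RB0 + D`), `HPx` (extra pairs `Px0` at the raised index), `HRs` (cells against the seed depth), any `Kmin ≥ 200`, GIVEN the four root reading
rows at the tuple read at the raised index (`HX1 HXA HX2 HYA`).  Inside: the Px choice data give `AtQNQ` of the U data (`atQ3V_of_atQ3VPx`), the width floors
(`D_le_nL/nKit/k/nB0_of_atQ3VPx`) and `hRK` («SkelFrmFromBParamsKitBump».RK_add_le_RK_raise_of_atQ); then §1/§2 by «SkelFrmFrom1RootGlueQVKPx».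
SLOT LEDGER Px (R): these five H-hypotheses are what the node tuple must clear for the (R) column. [cite: KozmaNitzan2024, §4 p. 28 ((32) at the root)] -/
theorem rootHoldsNQWFnLKPxAt_frmChoiceAllQ3VPx_R (D Kmin mk : ℕ) (hKmin : 200 ≤ Kmin) (gv fv : Neg.FSlot) (Pv : PSlot) (ex mx : GSlot) (cv hv : CSlot) (bv : BSlot)
    (HgR : ∀ (κ : Consts) {V : Type} [DecidableEq V] [Countable V] {G : SimpleGraph V} [G.LocallyFinite] (Φ : PlanarSkeletonFrmQuasi G) (t : V) (p : unitInterval) (Dr : DataNS V),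
      gFloorKG κ Φ t p Dr (KS.RK t Dr mk + D) ≤ gv κ Φ t p Dr ∧ 40 * Neg.K κ * KS0.R'0N κ Φ (KS.NQ Φ) t p Dr (KS.RK t Dr mk + D) ≤ gv κ Φ t p Dr ∧ 60 * (KS.Rs t Dr (KS.RK t Dr mk + D) + 1) ≤ gv κ Φ t p Dr ∧
        2 * fv κ Φ t p Dr + 5 * KS0.R'0N κ Φ (KS.NQ Φ) t p Dr (KS.RK t Dr mk + D) + 3 ≤ gv κ Φ t p Dr)
    (HfR : ∀ (κ : Consts) {V : Type} [DecidableEq V] [Countable V] {G : SimpleGraph V} [G.LocallyFinite] (Φ : PlanarSkeletonFrmQuasi G) (t : V) (p : unitInterval) (Dr : DataNS V), KS.fxR0 κ Φ t p Dr (KS.RK t Dr mk + D) ≤ fv κ Φ t p Dr)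
    (HexR : ∀ (κ : Consts) {V : Type} [DecidableEq V] [Countable V] {G : SimpleGraph V} [G.LocallyFinite] (Φ : PlanarSkeletonFrmQuasi G) (t : V) (p : unitInterval) (Dr : DataNS V) (g f : ℕ),
      KS0.r₀0N (KS.NQ Φ) t Dr (KS.RK t Dr mk + D) (RLD κ Φ t p Dr g f + D) + 1 ≤ ex κ Φ t p Dr g f ∧ KS0.r₀0N (KS.NQ Φ) t Dr (KS.RK t Dr mk + D) (KS.RB0 κ Φ t p Dr (KS.RK t Dr mk + D) + D) + 1 ≤ ex κ Φ t p Dr g f ∧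
      Φ.M * KS.Yb0 κ Φ t p Dr (KS.RK t Dr mk + D) g f + 1 ≤ ex κ Φ t p Dr g f ∧
      Φ.M * KS.D0s κ Φ t p Dr (KS.RK t Dr mk + D) g f (kgq κ Φ t p Dr g f (qxQ4 κ Φ t p Dr g f)) + ZD2 κ Φ t p Dr g f + Φ.M * 13 * (kgSL (nL κ Φ t p Dr g f) (ℓL κ Φ t p Dr g f) (hL κ Φ t p Dr g f)).toNat + 1 ≤ ex κ Φ t p Dr g f ∧
      Φ.M * KS.D0s κ Φ t p Dr (KS.RK t Dr mk + D) g f (kgq κ Φ t p Dr g f 0) + KS.ZDP κ Φ t p Dr g f + 1 ≤ ex κ Φ t p Dr g f ∧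
      Φ.M * KS.D2R κ Φ t p Dr (KS.RK t Dr mk + D) g f (WxYQ4 κ Φ t p Dr g f) + ZDYW κ Φ t p Dr g f + Φ.M * 13 * nL κ Φ t p Dr g f + 1 ≤ ex κ Φ t p Dr g f)
    (HPx : ∀ (κ : Consts) {V : Type} [DecidableEq V] [Countable V] {G : SimpleGraph V} [G.LocallyFinite] (Φ : PlanarSkeletonFrmQuasi G) (t : V) (p : unitInterval) (Dr : DataNS V), (KS.Px0 (KS.RK t Dr mk + D) κ Φ t p Dr).1 ⊆ (Pv κ Φ t p Dr).1)
    (HRs : ∀ (κ : Consts) {V : Type} [DecidableEq V] [Countable V] {G : SimpleGraph V} [G.LocallyFinite] (Φ : PlanarSkeletonFrmQuasi G) (t : V) (p : unitInterval) (Dr : DataNS V) (f : ℕ), EqNumL κ Φ t p Dr (gv κ Φ t p Dr) f →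
      (hL κ Φ t p Dr (gv κ Φ t p Dr) f).natAbs ≤ 10 * nL κ Φ t p Dr (gv κ Φ t p Dr) f → ∀ i, KS.Rs t Dr (KS.RK t Dr mk + D) + 1 ≤ 5 * (fcellsA κ Φ t p Dr (gv κ Φ t p Dr) f).r i)
    (HX1 : ∀ (κ : Consts) {V : Type} [DecidableEq V] [Countable V] {G : SimpleGraph V} [G.LocallyFinite] (Φ : PlanarSkeletonFrmQuasi G) (t : V) (p : unitInterval) (hC : Φ.CylSubcritical p) (O : OutNS V) (q : unitInterval),
      200 ≤ κ.K₀ → (choiceAtQ3V κ Φ t p Pv gv fv (SUS ex mx) cv hv bv hC).AtQNQ O q →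
      KS.RowX1 κ Φ t p O.merged (KS.RK t O.merged mk + D) (gOf κ Φ t p O gv) (fOf κ Φ t p O fv) (qxQ4 κ Φ t p O.merged (gOf κ Φ t p O gv) (fOf κ Φ t p O fv)) (WxQ4 κ Φ t p O.merged (gOf κ Φ t p O gv) (fOf κ Φ t p O fv)))
    (HXA : ∀ (κ : Consts) {V : Type} [DecidableEq V] [Countable V] {G : SimpleGraph V} [G.LocallyFinite] (Φ : PlanarSkeletonFrmQuasi G) (t : V) (p : unitInterval) (hC : Φ.CylSubcritical p) (O : OutNS V) (q : unitInterval)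
      (hK0 : 200 ≤ κ.K₀) (hAt : (choiceAtQ3V κ Φ t p Pv gv fv (SUS ex mx) cv hv bv hC).AtQNQ O q) (hg : gFloorKG κ Φ t p O.merged (KS.RK t O.merged mk + D) ≤ gOf κ Φ t p O gv),
      KS.RowXA κ Φ t p O.merged (KS.RK t O.merged mk + D) (gOf κ Φ t p O gv) (fOf κ Φ t p O fv) (qxQ4 κ Φ t p O.merged (gOf κ Φ t p O gv) (fOf κ Φ t p O fv)) (WxQ4 κ Φ t p O.merged (gOf κ Φ t p O gv) (fOf κ Φ t p O fv))
        (cOf κ Φ t p O gv fv cv) (bOf κ Φ t p O gv fv bv) (eqNumL_of_atQ (atQ3_of_atQ3V hAt)) hg)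
    (HX2 : ∀ (κ : Consts) {V : Type} [DecidableEq V] [Countable V] {G : SimpleGraph V} [G.LocallyFinite] (Φ : PlanarSkeletonFrmQuasi G) (t : V) (p : unitInterval) (hC : Φ.CylSubcritical p) (O : OutNS V) (q : unitInterval),
      200 ≤ κ.K₀ → (choiceAtQ3V κ Φ t p Pv gv fv (SUS ex mx) cv hv bv hC).AtQNQ O q → KS.RowX2 κ Φ t p O.merged (KS.RK t O.merged mk + D) (gOf κ Φ t p O gv) (fOf κ Φ t p O fv))
    (HYA : ∀ (κ : Consts) {V : Type} [DecidableEq V] [Countable V] {G : SimpleGraph V} [G.LocallyFinite] (Φ : PlanarSkeletonFrmQuasi G) (t : V) (p : unitInterval) (hC : Φ.CylSubcritical p) (O : OutNS V) (q : unitInterval)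
      (hK0 : 200 ≤ κ.K₀) (hAt : (choiceAtQ3V κ Φ t p Pv gv fv (SUS ex mx) cv hv bv hC).AtQNQ O q) (hg : gFloorKG κ Φ t p O.merged (KS.RK t O.merged mk + D) ≤ gOf κ Φ t p O gv),
      KS.RowYA κ Φ t p O.merged (KS.RK t O.merged mk + D) (gOf κ Φ t p O gv) (fOf κ Φ t p O fv) (qxYQ4 κ Φ t p O.merged (gOf κ Φ t p O gv) (fOf κ Φ t p O fv)) (WxYQ4 κ Φ t p O.merged (gOf κ Φ t p O gv) (fOf κ Φ t p O fv))
        (cOf κ Φ t p O gv fv cv) (bOf κ Φ t p O gv fv bv) (eqNumL_of_atQ (atQ3_of_atQ3V hAt)) hg) :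
    RootHoldsNQWFnLKPxAt LfQ Kmin (frmChoiceAllQ3VPx D gv fv Pv (SUS ex mx) cv hv bv) := by
  refine rootHoldsNQWFnLKPxAt_frmChoiceAllQ3VPx_of_axes LfQ Kmin D gv fv Pv (SUS ex mx) cv hv bv fun κ V _ _ G _ Φ t p hC O q hK hAt hP hp0 hp1 _ a => ?_
  have hK : 200 ≤ κ.K₀ := hKmin.trans hK
  have hAtV := atQ3V_of_atQ3VPx hAt
  have hN := eqNumL_of_atQ (atQ3_of_atQ3V hAtV)
  -- the raised kit index `mkP := RK mk + D` (K-2, «SkelFrmFromBParamsKitBump» §4) and the width floors from the Px choice data («SkelFrmFromBChoiceDefsVPx» §2/§4)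
  have hRK := RK_add_le_RK_raise_of_atQ mk (D := D) (atQ3_of_atQ3VPx hAt)
  have hnL := D_le_nL_of_atQ3VPx hAt (gOf κ Φ t p O gv) (fOf κ Φ t p O fv)
  have hnK := D_le_nKit_of_atQ3VPx hAt mk
  have hDk := D_le_k_of_atQ3VPx hAt
  have hnB0 := D_le_nB0_of_atQ3VPx hAt (KS.RK t O.merged mk + D)
  obtain ⟨hgK, hg2, hgR, hfg⟩ := HgR κ Φ t p O.merged
  have hf := HfR κ Φ t p O.merged
  obtain ⟨hexRL, hexRB, hexYb, hexZ, hexP, hexY⟩ := HexR κ Φ t p O.merged (gOf κ Φ t p O gv) (fOf κ Φ t p O fv)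
  have hPx := HPx κ Φ t p O.merged
  have hRs5 := HRs κ Φ t p O.merged (fOf κ Φ t p O fv) hN (clauseL_of_atQ (atQ3_of_atQ3V hAtV)).2
  fin_cases a
  · exact rootLeg_fst_Q3V_of_rowsPx hAtV hP hp0 hp1 mk (KS.RK t O.merged mk + D) hnL hnK hDk hnB0 hRK hgK hg2 hfg hf hexRL hexRB hexYb hexZ hPx hRs5
      (HX1 κ Φ t p hC O q hK hAtV) (HXA κ Φ t p hC O q hK hAtV hgK)
  · exact rootLeg_snd_Q3V_of_rowsPx hAtV hP hp0 hp1 mk (KS.RK t O.merged mk + D) hnL hnK hDk hnB0 hRK hK hgK hg2 hgR hfg hf hexRL hexRB hexYb hexP hexY hPx hRs5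
      (HX2 κ Φ t p hC O q hK hAtV) (HYA κ Φ t p hC O q hK hAtV hgK)

end NegB

end PlanarSkeletonFrmQuasi

end Summit.CriticalPhenomena.PercolationContinuityZ3.Theorems.Transplant

end
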